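import Summits.AtomisticToContinuum.HydrodynamicLimit.Theorems.BoxDissipativeWeakStrongRelativeEnergyStabilityGronwallIntegrablePieces
import Summits.AtomisticToContinuum.HydrodynamicLimit.Theorems.BoxDissipativeWeakStrongEntropyAdmissibilityStubDynPartIntegrable
import HarnessLib

/-!
# Crux `RelativeEnergyStability` (stmt-AtomisticToContinuum-17653), line `registered`, heart stub S-X —
# expectation layer (D1): joint measurability of the clamped box energy observable (`sx_measurable_obsPsi`)

Registered sub-goal of the heart stub S-X. Under the strong-side conjunction `S` of `…GronwallStrong` (EOS fact data
`(η₀, F)`, band `η₁ ≤ η₁B < η₀/2`, smooth band extension `(χ, f)`, classical hard-sphere Euler solution `(ρ,u,θ)` on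
`[0,T)` with the guard `ρσ³ ≤ η₁/2`), for a jointly MEASURABLE version `Ψ : ℝ × Config → Config` of the hard-sphere
flow (`stub_flowJointMeasurable`), a window `l > 0`, clamps `a, b` and `τ ∈ [0,T)`, the map
`p = (t, z) ↦ ẽ(p) = ∫ ℰ_{Z_{a,b}}(Û(Ψ(πt, z))(x) | (ρ,u,θ)(πt, x)) dx`, `πt = max 0 (min t τ)` (time clamped into
`[0,τ]`), is measurable — the input of `StronglyMeasurable.integral_prod_right'` / Fubini in `(t, z)` for the Grönwall
step in expectation.

Proof (measure theory only, the template of `sx_integrableOn_obs`): the integrand is jointly measurable in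
`((t, z), x)` — in the tested form `ℰ_Z = Ê − m̂·u + ρ̂φ₁ − θ ρ̂ Z_{a,b}(ŝ) + p_cut(ρ,θ)` (`sx_clampedRelEnergy_box`) the
box fields are jointly measurable in `(configuration, point)` (`LGFS.measurable_empirical*Field_param`) composed with
the measurable `p ↦ Ψ(πp.1, p.2)`; the clamped cut entropy by `EABirthS1a.measurable_statEntropy` (`f_ex` continuous on
`[0, η₀) ⊇ [0, η₁]` by the EOS fact); the strong fields `u, θ, ρ` and `φ₁` (`sx_energyTest_smooth`) are continuous on
the slab hence jointly measurable after the time clamp (`EABirthS1a.measurable_clampTime`); `p_cut = ρθ Z(min(ρσ³,η₁))`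
with `Z = 1 + η f_ex'` measurable (`measurable_deriv`). Then `StronglyMeasurable.integral_prod_right'`.

References: BrezinaFeireisl2018 §3.1–3.2 (the quantity); measure theory only.
-/

noncomputable section

namespace Summit.AtomisticToContinuum.HydrodynamicLimit.Theorems.RES

open MeasureTheory Filter Set Function
open scoped Topology InnerProductSpace ENNReal
open Summit.AtomisticToContinuum.HydrodynamicLimit.Theses.BoxDissipativeWeakStrong
open Literature.MathematicalPhysics.KineticTheory Literature.Analysis.FluidPDE Literature.Analysis.FunctionSpaces
open Literature.Analysis.FluidPDE.CompressibleEuler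
open Literature.Analysis.FluidPDE.CompressibleEuler.EulerPhase
open Literature.Analysis.FluidPDE.CompressibleEuler.StrongPointData

/-- **Joint measurability of the clamped box energy integrand** in `((t, z), x)`, the configuration being read through
a measurable `Ψ : ℝ × Config → Config` at the clamped time `πt = max 0 (min t τ)` and the strong data at `(πt, x)`. -/
theorem om_measurable_integrand {η₀ η₁ η₁B σ T : ℝ} {F χ f : ℝ → ℝ} {ρ θ : ℝ → T3 → ℝ} {u : ℝ → T3 → V3}
    (S : AnalyticOnNhd ℝ F (Ioo (-η₀) η₀) ∧ EqOn hsExcessFreeEnergy F (Ico 0 η₀) ∧ 0 < η₁ ∧ η₁ ≤ η₁B ∧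
      2 * η₁B < η₀ ∧ 0 < σ ∧
      (∀ x, 0 < x → x * σ ^ 3 ≤ η₁B → f x = hsExcessFreeEnergy (x * σ ^ 3) ∧ χ x = hsCompressibility (x * σ ^ 3)) ∧
      (EulerEOS.monatomicExcess χ f).IsGibbs ∧ IsHardSphereEulerSolution σ T ρ u θ ∧
      ∀ t ∈ Ico 0 T, ∀ x, ρ t x * σ ^ 3 ≤ η₁ / 2)
    {N : ℕ} {Ψ : ℝ × Config (N + 1) (Fin 3) T3 → Config (N + 1) (Fin 3) T3} (hΨ : Measurable Ψ)
    {l : ℝ} (hl : 0 ≤ l) (a b : ℝ) {τ : ℝ} (hτ : τ ∈ Ico 0 T) :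
    Measurable (fun q : (ℝ × Config (N + 1) (Fin 3) T3) × T3 =>
      clampedRelEnergy σ η₁ a b (ρ (max 0 (min q.1.1 τ)) q.2) (u (max 0 (min q.1.1 τ)) q.2)
        (θ (max 0 (min q.1.1 τ)) q.2) (boxState l (Ψ (max 0 (min q.1.1 τ), q.1.2)) q.2)) := by
  have hsol : IsHardSphereEulerSolution σ T ρ u θ := S.2.2.2.2.2.2.2.2.1
  have hη₁ : 0 < η₁ := S.2.2.1
  have hσ : 0 < σ := S.2.2.2.2.2.1
  have hη₁₀ : η₁ < η₀ := sx_band_lt S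
  have hη₀ : 0 < η₀ := hη₁.trans hη₁₀
  have hcont : ContinuousOn hsExcessFreeEnergy (Ico 0 η₀) :=
    (S.1.continuousOn.mono fun η hη => ⟨(neg_lt_zero.2 hη₀).trans_le hη.1, hη.2⟩).congr S.2.1
  have hIcc : Icc 0 τ ⊆ Ico 0 T := fun s hs => ⟨hs.1, hs.2.trans_lt hτ.2⟩
  -- the measurable reparametrisations `q ↦ (Ψ(πq.1.1, q.1.2), q.2)` and `q ↦ (q.1.1, q.2)`
  have hc : Measurable fun q : (ℝ × Config (N + 1) (Fin 3) T3) × T3 => max 0 (min q.1.1 τ) :=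
    measurable_const.max ((measurable_fst.comp measurable_fst).min measurable_const)
  have hwx : Measurable fun q : (ℝ × Config (N + 1) (Fin 3) T3) × T3 => (Ψ (max 0 (min q.1.1 τ), q.1.2), q.2) :=
    (hΨ.comp (hc.prodMk (measurable_snd.comp measurable_fst))).prodMk measurable_snd
  have htx : Measurable fun q : (ℝ × Config (N + 1) (Fin 3) T3) × T3 => (q.1.1, q.2) :=
    (measurable_fst.comp measurable_fst).prodMk measurable_snd
  -- box fields and the clamped cut entropy
  have hR := (LGFS.measurable_empiricalDensityField_param (n := N + 1) (k := boxKernel l)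
    (LGFS.measurable_boxK_uncurry l)).comp hwx
  have hM := (LGFS.measurable_empiricalMomentumField_param (n := N + 1) (k := boxKernel l)
    (LGFS.measurable_boxK_uncurry l)).comp hwx
  have hE := (LGFS.measurable_empiricalEnergyField_param (n := N + 1) (k := boxKernel l)
    (LGFS.measurable_boxK_uncurry l)).comp hwx
  have hG := (EABirthS1a.measurable_statEntropy (N := N) hcont hσ.le hη₁.le hη₁₀ hl a b).comp hwx
  -- strong fields and `φ₁` at the clamped time (continuous on the slab `[0,T) × 𝕋³`)
  have hu₀ : Measurable fun q : ℝ × T3 => u (max 0 (min q.1 τ)) q.2 :=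
    EABirthS1a.measurable_clampTime hsol.smooth_velocity.continuousOn_stLift hτ.1 hIcc
  have hθ₀ : Measurable fun q : ℝ × T3 => θ (max 0 (min q.1 τ)) q.2 :=
    EABirthS1a.measurable_clampTime hsol.smooth_temperature.continuousOn_stLift hτ.1 hIcc
  have hρ₀ : Measurable fun q : ℝ × T3 => ρ (max 0 (min q.1 τ)) q.2 :=
    EABirthS1a.measurable_clampTime hsol.smooth_density.continuousOn_stLift hτ.1 hIcc
  have hφ₀ : Measurable fun q : ℝ × T3 => energyTestFunction (cutEOS σ η₁) ρ u θ (max 0 (min q.1 τ)) q.2 :=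
    EABirthS1a.measurable_clampTime (sx_energyTest_smooth S).continuousOn_stLift hτ.1 hIcc
  have hu' : Measurable fun q : (ℝ × Config (N + 1) (Fin 3) T3) × T3 => u (max 0 (min q.1.1 τ)) q.2 :=
    (hu₀.comp htx :)
  have hθ' : Measurable fun q : (ℝ × Config (N + 1) (Fin 3) T3) × T3 => θ (max 0 (min q.1.1 τ)) q.2 :=
    (hθ₀.comp htx :)
  have hρ' : Measurable fun q : (ℝ × Config (N + 1) (Fin 3) T3) × T3 => ρ (max 0 (min q.1.1 τ)) q.2 :=
    (hρ₀.comp htx :)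
  have hφ' : Measurable fun q : (ℝ × Config (N + 1) (Fin 3) T3) × T3 =>
      energyTestFunction (cutEOS σ η₁) ρ u θ (max 0 (min q.1.1 τ)) q.2 :=
    (hφ₀.comp htx :)
  have mhs : Measurable hsCompressibility := measurable_const.add (measurable_id.mul (measurable_deriv _))
  have hp' : Measurable fun q : (ℝ × Config (N + 1) (Fin 3) T3) × T3 =>
      (cutEOS σ η₁).p (ρ (max 0 (min q.1.1 τ)) q.2) (θ (max 0 (min q.1.1 τ)) q.2) := by
    simp only [tz_p_eq, cutCompressibility]
    exact (hρ'.mul hθ').mul (mhs.comp ((hρ'.mul_const _).min measurable_const))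
  -- the tested form
  simp only [sx_clampedRelEnergy_box]
  have hSt : Measurable fun q : (ℝ × Config (N + 1) (Fin 3) T3) × T3 =>
      (boxState l (Ψ (max 0 (min q.1.1 τ), q.1.2)) q.2).1 *
        EABirthS1a.statEntropy σ η₁ l a b (Ψ (max 0 (min q.1.1 τ), q.1.2)) q.2 := hR.mul hG
  exact (((hE.sub (hM.inner hu')).add (hR.mul hφ')).sub (hθ'.mul hSt)).add hp'

/-- (D1) joint measurability in `(t, z)` of the clamped box energy observable read through a jointly measurable version
`Ψ` of the flow and with time clamped to `[0, τ]`. -/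
theorem sx_measurable_obsPsi {η₀ η₁ η₁B σ T : ℝ} {F χ f : ℝ → ℝ} {ρ θ : ℝ → T3 → ℝ} {u : ℝ → T3 → V3}
    (S : AnalyticOnNhd ℝ F (Ioo (-η₀) η₀) ∧ EqOn hsExcessFreeEnergy F (Ico 0 η₀) ∧ 0 < η₁ ∧ η₁ ≤ η₁B ∧
      2 * η₁B < η₀ ∧ 0 < σ ∧
      (∀ x, 0 < x → x * σ ^ 3 ≤ η₁B → f x = hsExcessFreeEnergy (x * σ ^ 3) ∧ χ x = hsCompressibility (x * σ ^ 3)) ∧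
      (EulerEOS.monatomicExcess χ f).IsGibbs ∧ IsHardSphereEulerSolution σ T ρ u θ ∧
      ∀ t ∈ Ico 0 T, ∀ x, ρ t x * σ ^ 3 ≤ η₁ / 2)
    {N : ℕ} {Ψ : ℝ × Config (N + 1) (Fin 3) T3 → Config (N + 1) (Fin 3) T3} (hΨ : Measurable Ψ)
    {l : ℝ} (hl : 0 < l) (a b : ℝ) {τ : ℝ} (hτ : τ ∈ Ico 0 T) :
    Measurable (fun p : ℝ × Config (N + 1) (Fin 3) T3 => ∫ x,
      clampedRelEnergy σ η₁ a b (ρ (max 0 (min p.1 τ)) x) (u (max 0 (min p.1 τ)) x) (θ (max 0 (min p.1 τ)) x)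
        (boxState l (Ψ (max 0 (min p.1 τ), p.2)) x)) :=
  ((om_measurable_integrand S hΨ hl.le a b hτ).stronglyMeasurable.integral_prod_right' (ν := volume)).measurable

end Summit.AtomisticToContinuum.HydrodynamicLimit.Theorems.RES

end
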